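import Summits.QuantumFields.GaugeBoot.FullSpaceGroupBootstrapConvergenceZd
import Summits.QuantumFields.GaugeBoot.BootstrapBoundsConvergenceZd
import HarnessLib

/-!
# The SDP bounds reduced by the full space group `B_d ⋉ ℤ^d` converge to the extrema over the Gibbs states with the full lattice symmetry (gauge-boot, L1/L4 supplement)

HONEST FRAMING (cell `pub-gaugeboot`, page 1 of every file): the venture produces certified bounds
on lattice expectations at stated coupling, gauge group, dimension and torus size; NOT a mass gap,
NOT a continuum limit, NOT a string tension; NOT Yang–Mills-summit-bearing (barriers
`FixedCouplingUltralocality`, `PerturbativeInvisibility`). Structural; it certifies no number.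

## Content (`SU(N)` on `ℤ^d`, any real `β`, any polynomial observable `P`)

The `sup / inf` form of `FullSpaceGroupBootstrapConvergenceZd`, parallel to
`BootstrapBoundsConvergenceZd` (plain ⟶ all Gibbs states; translations ⟶ homogeneous phases):

* `fullDlrValuesSuN N β P` — the expectations of `P` over the Gibbs states invariant under all
  translations, axis permutations and axis reflections; non-empty (such states exist,
  `exists_dlr_fullSpaceGroupInvariant_suN`), bounded, `⊆ invDlrValues ⊆ dlrValues`; sound at every
  level (`fullDlrValues_subset_fullSymLevelValuesZd_suN`); `fullSymLevelValuesZd_anti`,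
  `bdd_fullSymLevelValuesZd_suN`;
* ★★★ `tendsto_sSup_fullSymLevelValuesZd_suN` / `tendsto_sInf_fullSymLevelValuesZd_suN` — THE FULLY
  REDUCED level-`n` SDP bounds converge, as `n → ∞`, to `sup / inf` of `∫ P dμ` over the Gibbs
  states carrying the full lattice symmetry;
* ★★ `sSup_fullDlrValues_le_suN` — the three limits are ordered: full `≤` translation-invariant `≤`
  all (upper bounds; dually for lower bounds);
* ★★ `tendsto_sSup_fullSymLevelValuesZd_suN_of_small` — at strong coupling
  (`6(d-1)N|β| < 1`, unique Gibbs state `ν`) all three hierarchies converge to the one number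
  `∫ P dν`: in the uniqueness window the whole symmetry reduction costs nothing in the limit.

What this is NOT: whether the three limits differ at some `β` (spontaneous breaking of a lattice
symmetry); rates in `n`.

References: V. Kazakov, Z. Zheng, arXiv:2203.11360 §3.3; H.-O. Georgii, Gibbs Measures and Phase
Transitions (2011) Ch. 5. Folklore.
-/

noncomputable section

open MeasureTheory Filter Topology
open Literature.MathematicalPhysics.QuantumFieldTheory (LatticeRep ymGibbsMeasures_nonempty)
open Literature.MathematicalPhysics.QuantumLattice

namespace Summit.QuantumFields.GaugeBoot

section ZdSuN

variable {d : ℕ} (N : ℕ) (β : ℝ)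

/-- **The fully symmetric Gibbs values of `P`**: expectations over the Gibbs states invariant under
translations, axis permutations and axis reflections. [folklore] -/
def fullDlrValuesSuN (P : C(LGConfig d (Matrix.specialUnitaryGroup (Fin N) ℂ), ℝ)) : Set ℝ :=
  {t | ∃ μ ∈ ymGibbsMeasures (d := d) (fundamentalRep (Fin N)) β, IsZdTranslationInvariant μ ∧
    (∀ σ : Equiv.Perm (Fin d), μ.map (relabelConfig (edgePerm σ)) = μ) ∧
    (∀ i : Fin d, μ.map (configSiteReflect i) = μ) ∧ ∫ U, P U ∂μ = t}

/-- Fully symmetric Gibbs values are translation-invariant Gibbs values. -/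
theorem fullDlrValues_subset_invDlrValues_suN (P : C(LGConfig d (Matrix.specialUnitaryGroup (Fin N) ℂ), ℝ)) :
    fullDlrValuesSuN (d := d) N β P ⊆ invDlrValuesSuN (d := d) N β P := by
  rintro t ⟨μ, hμ, hT, -, -, rfl⟩
  exact ⟨μ, hμ, hT, rfl⟩

/-- The fully symmetric Gibbs values form a non-empty bounded set. -/
theorem fullDlrValues_nonempty_bdd_suN (P : C(LGConfig d (Matrix.specialUnitaryGroup (Fin N) ℂ), ℝ)) :
    (fullDlrValuesSuN (d := d) N β P).Nonempty ∧ BddAbove (fullDlrValuesSuN (d := d) N β P) ∧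
      BddBelow (fullDlrValuesSuN (d := d) N β P) := by
  obtain ⟨ν, hν, hT, hperm, hrefl⟩ := exists_dlr_fullSpaceGroupInvariant_suN (d := d) N β
  obtain ⟨-, hA, hB⟩ := invDlrValues_nonempty_bdd_suN N β P
  exact ⟨⟨_, ν, hν, hT, hperm, hrefl, rfl⟩, hA.mono (fullDlrValues_subset_invDlrValues_suN N β P),
    hB.mono (fullDlrValues_subset_invDlrValues_suN N β P)⟩

/-- **Soundness at every level (full reduction)**: fully symmetric Gibbs values are fully reduced
level-`n` values. -/
theorem fullDlrValues_subset_fullSymLevelValuesZd_suN (n : ℕ)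
    (P : C(LGConfig d (Matrix.specialUnitaryGroup (Fin N) ℂ), ℝ)) :
    fullDlrValuesSuN (d := d) N β P ⊆ fullSymLevelValuesZdSuN (d := d) N β n P := by
  rintro t ⟨μ, hμ, hT, hperm, hrefl, rfl⟩
  exact dlr_integral_mem_fullSymLevelValuesZd N β n hμ hT hperm hrefl P

/-- **Higher level, fewer fully reduced values.** -/
theorem fullSymLevelValuesZd_anti {m n : ℕ} (hmn : n ≤ m)
    (P : C(LGConfig d (Matrix.specialUnitaryGroup (Fin N) ℂ), ℝ)) :
    fullSymLevelValuesZdSuN (d := d) N β m P ⊆ fullSymLevelValuesZdSuN (d := d) N β n P := by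
  rintro t ⟨φ, hφ, hT, hperm, hrefl, rfl⟩
  exact ⟨φ, hφ.mono (fundamentalLatticeRep N) (wordTruncation_mono _ hmn),
    fun v x hx => hT v x (wordTruncation_mono _ (Nat.add_le_add hmn hmn) hx),
    fun σ x hx => hperm σ x (wordTruncation_mono _ (Nat.add_le_add hmn hmn) hx),
    fun i x hx => hrefl i x (wordTruncation_mono _ (Nat.add_le_add hmn hmn) hx), rfl⟩

/-- Boundedness and non-emptiness of the fully reduced values on the certificate domain. -/
theorem bdd_fullSymLevelValuesZd_suN {n : ℕ} {P : C(LGConfig d (Matrix.specialUnitaryGroup (Fin N) ℂ), ℝ)}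
    (hP : P ∈ certDomainZdSuN (d := d) N β n) :
    BddAbove (fullSymLevelValuesZdSuN (d := d) N β n P) ∧ BddBelow (fullSymLevelValuesZdSuN (d := d) N β n P) ∧
      (fullSymLevelValuesZdSuN (d := d) N β n P).Nonempty := by
  obtain ⟨hA, hB, -⟩ := bdd_symLevelValuesZd_suN N β hP
  have hsub : fullSymLevelValuesZdSuN (d := d) N β n P ⊆ symLevelValuesZdSuN (d := d) N β n P :=
    (fullSymLevelValuesZd_subset_spaceSymLevelValuesZd N β n P).trans
      (spaceSymLevelValuesZd_subset_symLevelValuesZd N β n P)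
  obtain ⟨hne, -, -⟩ := fullDlrValues_nonempty_bdd_suN (d := d) N β P
  exact ⟨hA.mono hsub, hB.mono hsub, hne.mono (fullDlrValues_subset_fullSymLevelValuesZd_suN N β n P)⟩

/-! ### The limits -/

/-- ★★★ **The fully reduced SDP upper bounds on `ℤ^d` converge to the supremum of `∫ P dμ` over the
Gibbs states with the FULL lattice symmetry** (translations, axis permutations, axis reflections).
`SU(N)`, any real `β`, any polynomial `P`. [folklore] -/
theorem tendsto_sSup_fullSymLevelValuesZd_suN {P : C(LGConfig d (Matrix.specialUnitaryGroup (Fin N) ℂ), ℝ)}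
    (hP : P ∈ polyAlgebra (ι := ZdEdge d) (fundamentalLatticeRep N)) :
    Tendsto (fun n => sSup (fullSymLevelValuesZdSuN (d := d) N β n P)) atTop
      (𝓝 (sSup (fullDlrValuesSuN (d := d) N β P))) := by
  obtain ⟨hDne, hDbdd, -⟩ := fullDlrValues_nonempty_bdd_suN (d := d) N β P
  set S := sSup (fullDlrValuesSuN (d := d) N β P)
  rw [Metric.tendsto_atTop]
  intro ε hε
  obtain ⟨n₁, hn₁⟩ := fullSymBootstrap_convergence_dlr_suN (d := d) N β hP (half_pos hε)
  obtain ⟨n₂, hn₂⟩ := (eventually_mem_certDomainZd_suN N β hP).exists_forall_of_atTop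
  refine ⟨max n₁ n₂, fun n hn => ?_⟩
  obtain ⟨hbdd, -, hne⟩ := bdd_fullSymLevelValuesZd_suN N β (hn₂ n ((le_max_right _ _).trans hn))
  have hup : sSup (fullSymLevelValuesZdSuN (d := d) N β n P) ≤ S + ε / 2 := by
    refine csSup_le hne fun t ht => ?_
    obtain ⟨μ, hμ, hT, hperm, hrefl, hclose⟩ :=
      hn₁ t (fullSymLevelValuesZd_anti N β ((le_max_left _ _).trans hn) P ht)
    have h1 : ∫ U, P U ∂μ ≤ S := le_csSup hDbdd ⟨μ, hμ, hT, hperm, hrefl, rfl⟩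
    linarith [(abs_le.1 hclose).2]
  have hlow : S ≤ sSup (fullSymLevelValuesZdSuN (d := d) N β n P) :=
    csSup_le_csSup hbdd hDne (fullDlrValues_subset_fullSymLevelValuesZd_suN N β n P)
  rw [Real.dist_eq, abs_lt]
  constructor <;> linarith

/-- ★★★ **The fully reduced SDP lower bounds on `ℤ^d` converge to the infimum of `∫ P dμ` over the
Gibbs states with the full lattice symmetry.** [folklore] -/
theorem tendsto_sInf_fullSymLevelValuesZd_suN {P : C(LGConfig d (Matrix.specialUnitaryGroup (Fin N) ℂ), ℝ)}
    (hP : P ∈ polyAlgebra (ι := ZdEdge d) (fundamentalLatticeRep N)) :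
    Tendsto (fun n => sInf (fullSymLevelValuesZdSuN (d := d) N β n P)) atTop
      (𝓝 (sInf (fullDlrValuesSuN (d := d) N β P))) := by
  obtain ⟨hDne, -, hDbdd⟩ := fullDlrValues_nonempty_bdd_suN (d := d) N β P
  set S := sInf (fullDlrValuesSuN (d := d) N β P)
  rw [Metric.tendsto_atTop]
  intro ε hε
  obtain ⟨n₁, hn₁⟩ := fullSymBootstrap_convergence_dlr_suN (d := d) N β hP (half_pos hε)
  obtain ⟨n₂, hn₂⟩ := (eventually_mem_certDomainZd_suN N β hP).exists_forall_of_atTop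
  refine ⟨max n₁ n₂, fun n hn => ?_⟩
  obtain ⟨-, hbdd, hne⟩ := bdd_fullSymLevelValuesZd_suN N β (hn₂ n ((le_max_right _ _).trans hn))
  have hlow : S - ε / 2 ≤ sInf (fullSymLevelValuesZdSuN (d := d) N β n P) := by
    refine le_csInf hne fun t ht => ?_
    obtain ⟨μ, hμ, hT, hperm, hrefl, hclose⟩ :=
      hn₁ t (fullSymLevelValuesZd_anti N β ((le_max_left _ _).trans hn) P ht)
    have h1 : S ≤ ∫ U, P U ∂μ := csInf_le hDbdd ⟨μ, hμ, hT, hperm, hrefl, rfl⟩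
    linarith [(abs_le.1 hclose).1]
  have hup : sInf (fullSymLevelValuesZdSuN (d := d) N β n P) ≤ S :=
    csInf_le_csInf hbdd hDne (fullDlrValues_subset_fullSymLevelValuesZd_suN N β n P)
  rw [Real.dist_eq, abs_lt]
  constructor <;> linarith

/-- ★★ **The three limits are ordered**: full `≤` translation-invariant `≤` all (upper bounds), and
dually for lower bounds. -/
theorem sSup_fullDlrValues_le_suN (P : C(LGConfig d (Matrix.specialUnitaryGroup (Fin N) ℂ), ℝ)) :
    sSup (fullDlrValuesSuN (d := d) N β P) ≤ sSup (invDlrValuesSuN (d := d) N β P) ∧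
      sSup (invDlrValuesSuN (d := d) N β P) ≤ sSup (dlrValuesSuN (d := d) N β P) ∧
      sInf (dlrValuesSuN (d := d) N β P) ≤ sInf (invDlrValuesSuN (d := d) N β P) ∧
      sInf (invDlrValuesSuN (d := d) N β P) ≤ sInf (fullDlrValuesSuN (d := d) N β P) := by
  obtain ⟨hFne, -, -⟩ := fullDlrValues_nonempty_bdd_suN (d := d) N β P
  obtain ⟨-, hIA, hIB⟩ := invDlrValues_nonempty_bdd_suN (d := d) N β P
  obtain ⟨h1, h2⟩ := sSup_invDlrValues_le_suN (d := d) N β P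
  exact ⟨csSup_le_csSup hIA hFne (fullDlrValues_subset_invDlrValues_suN N β P), h1, h2,
    csInf_le_csInf hIB hFne (fullDlrValues_subset_invDlrValues_suN N β P)⟩

/-! ### Strong coupling -/

/-- At strong coupling the fully symmetric Gibbs values of `P` are the single number `∫ P dν`. -/
theorem fullDlrValues_eq_singleton_of_small {β : ℝ} (hβ : 6 * ((d - 1 : ℕ) : ℝ) * N * |β| < 1)
    {ν : Measure (LGConfig d (Matrix.specialUnitaryGroup (Fin N) ℂ))}
    (hν : ν ∈ ymGibbsMeasures (d := d) (fundamentalRep (Fin N)) β)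
    (P : C(LGConfig d (Matrix.specialUnitaryGroup (Fin N) ℂ), ℝ)) :
    fullDlrValuesSuN (d := d) N β P = {∫ U, P U ∂ν} := by
  have huniq : ∀ μ ∈ ymGibbsMeasures (d := d) (fundamentalRep (Fin N)) β, μ = ν := fun μ hμ =>
    subsingleton_ymGibbsMeasures_allGroups (fundamentalRep (Fin N)) (continuous_fundamentalRep _) hβ hμ hν
  obtain ⟨ν', hν', hT', hperm', hrefl'⟩ := exists_dlr_fullSpaceGroupInvariant_suN (d := d) N β
  have hνν' : ν' = ν := huniq ν' hν'
  ext t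
  constructor
  · rintro ⟨μ, hμ, -, -, -, rfl⟩
    rw [huniq μ hμ]
    rfl
  · rintro rfl
    exact ⟨ν', hν', hT', hperm', hrefl', by rw [hνν']⟩

/-- ★★ **At strong coupling the FULLY REDUCED SDP bounds on `ℤ^d` converge to `∫ P dν`** (`ν` the
unique Gibbs state): in the uniqueness window the reduction by the whole space group `B_d ⋉ ℤ^d`
costs nothing in the limit. [folklore] -/
theorem tendsto_sSup_fullSymLevelValuesZd_suN_of_small {β : ℝ} (hβ : 6 * ((d - 1 : ℕ) : ℝ) * N * |β| < 1)
    {ν : Measure (LGConfig d (Matrix.specialUnitaryGroup (Fin N) ℂ))}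
    (hν : ν ∈ ymGibbsMeasures (d := d) (fundamentalRep (Fin N)) β)
    {P : C(LGConfig d (Matrix.specialUnitaryGroup (Fin N) ℂ), ℝ)}
    (hP : P ∈ polyAlgebra (ι := ZdEdge d) (fundamentalLatticeRep N)) :
    Tendsto (fun n => sSup (fullSymLevelValuesZdSuN (d := d) N β n P)) atTop (𝓝 (∫ U, P U ∂ν)) ∧
      Tendsto (fun n => sInf (fullSymLevelValuesZdSuN (d := d) N β n P)) atTop (𝓝 (∫ U, P U ∂ν)) := by
  have h := fullDlrValues_eq_singleton_of_small N hβ hν P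
  have h1 := tendsto_sSup_fullSymLevelValuesZd_suN N β hP
  have h2 := tendsto_sInf_fullSymLevelValuesZd_suN N β hP
  rw [h, csSup_singleton] at h1
  rw [h, csInf_singleton] at h2
  exact ⟨h1, h2⟩

end ZdSuN

end Summit.QuantumFields.GaugeBoot

end
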